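import Literature.AlgebraicGeometry.AbelianSchemes.AbelianSchemePointsLie
import Literature.AlgebraicGeometry.AbelianSchemes.AbelianSchemeFibreEndomorphisms
import HarnessLib

/-!
# Presented ring actions on an abelian scheme; their effect on points and on `Lie(A/R)`; the scalar action of `R`
# on `Lie(A/R)` through `ε ↦ r ε` (cell hodgecm-mathlib rung 0, node F1-01b part (ii-a-1))

[Kottwitz1992, §5 (p. 390)] equips the abelian scheme `A` of a PEL moduli point with a ring homomorphism
`i : O_B → End(A)` and imposes the determinant condition (5.2) on the action of `O_B` on `Lie(A)`.  Following the cell's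
currency of record (B-plan1 g2 04:14:21Z, D1 = the tree precedent `AbelianScheme.exists_ringHom_fibreEnd` of
`AbelianSchemeFibreEndomorphisms.lean` §3), the action is PRESENTED, ring-structure-free and commutativity-free:

* `RingAction O 𝒜` — a function `ιR : O → (𝒜.X ⟶ 𝒜.X)` into group-scheme endomorphisms (`IsMonHom`), with `ιR 1 = 𝟙`,
  `ιR (a b) = ιR a ≫ ιR b`, `ιR (a + b) = ιR a · ιR b` (pointwise product, Mathlib's scoped `Hom.group`) — EXACTLY the hypotheses
  of `exists_ringHom_fibreEnd`, which it feeds by name (`RingAction.exists_ringHom_fibreEnd`: at every field point `φ` a ring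
  homomorphism `O →+* End (𝒜.fibre φ)`); no ring structure on `End`, [MumfordFogartyKirwan1994, Cor. 6.5] (commutativity) unasserted;
* the effect of a group-scheme endomorphism `f` on `S`-points, `endPointsHom f S : A(S) →* A(S)` (Mathlib `IsMonHom.monoidHom`,
  postcomposition), commuting with the maps `A(φ)` of `AbelianSchemePointsLie` (`pointsMap_comp_end`), hence preserving
  `Lie(A/R) = ker(A(R[ε]) → A(R))` (`comp_end_mem_Lie`); the induced `RingAction.lieEnd ι a : Lie →* Lie`;
* the SCALAR action of `r ∈ R` on `Lie(A/R)` through the `R`-algebra endomorphism `ε ↦ r ε` of `R[ε]` (`scaleEps r`, Mathlib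
  `DualNumber.lift`): `lieSMul r : Lie →* Lie`, with `lieSMul 1 = id`, `lieSMul (r s) = lieSMul r ∘ lieSMul s` and `lieSMul 0 P = 1`
  ([GortzWedhorn2020, (6.4)]: the `k`-structure of the tangent space `ker(X(k[ε]) → X(k))` comes from the `k`-algebra maps
  `ε ↦ λ ε`; [DemazureGabriel] II §4 1.2).

NOT here (part (ii-a-2), needs «`A(R[ε₁,ε₂]') = A(R[ε]) ×_{A(R)} A(R[ε])`», i.e. pushouts of square-zero thickenings of `Spec R`
in `Sch`, absent from Mathlib): ADDITIVITY `lieSMul (r + s) P = lieSMul r P · lieSMul s P` and the commutativity of `Lie(A/R)`, hence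
the `R`-MODULE structure; and the Kottwitz condition itself (part (ii-b), ruled D2b 04:14:21Z).  Definitions with bodies + proved
lemmas; no named fact, no `sorry`, no `instance` declaration (scoped Mathlib instances opened), no notation.

Cell hodgecm-mathlib, row I-1 programme (F1 DAG carriers; B-plan1 g2 04:14:21Z GO (ii-a)); typer seat B-typ01.  HC_CM is proved only
modulo the 7 printed citations until rung 0 closes; this file discharges none of them.

## References
* [Kottwitz1992] R. E. Kottwitz, J. Amer. Math. Soc. **5** (1992), §5 (pp. 389–392): `i : O_B → End(A)`, (5.2).
* [GortzWedhorn2020] U. Görtz, T. Wedhorn, *Algebraic Geometry I*, 2nd ed. (2020), (6.4) (p. 155) tangent spaces via `k[ε]`.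
* [MumfordFogartyKirwan1994] Ch. 6 §1 Def. 6.1, Cor. 6.5 (pp. 115–117).
* [Shimura1998] §12.4 Prop. 26 (proof p. 109) — through the tree's `exists_ringHom_fibreEnd`.
* Tree: `AbelianSchemes/AbelianSchemePointsLie.lean`, `AbelianSchemes/AbelianSchemeFibreEndomorphisms.lean`.
-/

universe u v

open CategoryTheory CategoryTheory.Limits AlgebraicGeometry
open scoped MonObj

noncomputable section

namespace Literature.AlgebraicGeometry.AbelianSchemes

open Literature.AlgebraicGeometry.Motives (SchemeOver specOver AbelianVariety)

namespace AbelianScheme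

variable {R : Type u} [CommRing R] (𝒜 : AbelianScheme R)

/-! ## Presented ring actions (the currency of `exists_ringHom_fibreEnd`) -/

/-- A **presented action of a commutative ring `O` on the abelian scheme `𝒜 / R` by group-scheme endomorphisms** —
[Kottwitz1992, §5]'s `i : O_B → End(A)` in the ring-structure-free currency of the tree's `exists_ringHom_fibreEnd`:
`ιR a` a homomorphism of group schemes, `ιR 1 = 𝟙`, `ιR (a b) = ιR a ≫ ιR b`, `ιR (a + b) = ιR a · ιR b` (pointwise product
in `Hom(𝒜, 𝒜)`, Mathlib scoped `Hom.group`). [cite: Kottwitz1992, §5 (p. 390)] [cite: Shimura1998, §12.4 Prop. 26 (proof, p. 109)] -/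
structure RingAction (O : Type v) [CommRing O] (𝒜 : AbelianScheme R) where
  /-- the endomorphism of `𝒜` attached to `a ∈ O` -/
  ιR : O → (𝒜.X ⟶ 𝒜.X)
  /-- each `ιR a` is a homomorphism of group schemes -/
  isMonHom : ∀ a, IsMonHom (ιR a)
  /-- `ιR 1 = id` -/
  map_one : ιR 1 = 𝟙 𝒜.X
  /-- `ιR (a b) = ιR a ≫ ιR b` -/
  map_mul : ∀ a b, ιR (a * b) = ιR a ≫ ιR b
  /-- `ιR (a + b) = ιR a · ιR b` (pointwise product) -/
  map_add : ∀ a b, ιR (a + b) = ιR a * ιR b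

namespace RingAction

variable {𝒜} {O : Type v} [CommRing O] (act : RingAction O 𝒜)

/-- **Specialisation to a field point is a ring homomorphism `O →+* End (𝒜_φ)`** — the tree's
`AbelianScheme.exists_ringHom_fibreEnd` fed by the fields of `ι` (not restated). [cite: Shimura1998, §12.4 Prop. 26 (proof, p. 109)] -/
theorem exists_ringHom_fibreEnd {κ : Type u} [Field κ] (φ : R →+* κ) :
    ∃ ικ : O →+* End (𝒜.fibre φ), ∀ a, (ικ a).hom.hom.hom = (Over.pullback (specMap φ)).map (act.ιR a) :=
  haveI := act.isMonHom
  𝒜.exists_ringHom_fibreEnd φ act.ιR act.map_one act.map_mul act.map_add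

/-- `ιR 0` is the trivial endomorphism (`ιR 0 = ιR (0 + 0) = ιR 0 · ιR 0`). [cite: Kottwitz1992, §5 (p. 390)] -/
theorem map_zero : act.ιR 0 = 1 := by
  have h : act.ιR 0 * act.ιR 0 = act.ιR 0 * 1 := by rw [mul_one, ← act.map_add, add_zero]
  exact mul_left_cancel h

end RingAction

/-! ## Endomorphisms act on points and preserve `Lie` -/

section End

variable {S S' : Type u} [CommRing S] [Algebra R S] [CommRing S'] [Algebra R S']

/-- The action of a group-scheme endomorphism `f` on `S`-points, `P ↦ P ≫ f`, a group homomorphism (Mathlib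
`IsMonHom.monoidHom`). [cite: GortzWedhorn2020, Section (4.1) and (4.7) (p. 135)] -/
def endPointsHom (f : 𝒜.X ⟶ 𝒜.X) [IsMonHom f] (S : Type u) [CommRing S] [Algebra R S] :
    𝒜.Points S →* 𝒜.Points S :=
  IsMonHom.monoidHom f (specOver R S)

/-- Unfolding: `endPointsHom f S P = P ≫ f`. [cite: GortzWedhorn2020, Section (4.7) (p. 135)] -/
@[simp]
theorem endPointsHom_apply (f : 𝒜.X ⟶ 𝒜.X) [IsMonHom f] (P : 𝒜.Points S) : 𝒜.endPointsHom f S P = P ≫ f := rfl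

/-- The maps `A(φ)` commute with the action of endomorphisms (associativity of composition).
[cite: GortzWedhorn2020, Section (4.7) (p. 135)] -/
theorem pointsMap_comp_end (φ : S →ₐ[R] S') (f : 𝒜.X ⟶ 𝒜.X) (P : 𝒜.Points S) :
    𝒜.pointsMap φ (P ≫ f) = 𝒜.pointsMap φ P ≫ f := by
  rw [pointsMap_apply, pointsMap_apply, Category.assoc]

/-- A group-scheme endomorphism preserves `Lie(A/R) = ker(A(R[ε]) → A(R))`. [cite: GortzWedhorn2020, Section (6.4) (p. 155)] -/
theorem comp_end_mem_Lie (f : 𝒜.X ⟶ 𝒜.X) [IsMonHom f] {P : 𝒜.Points (DualNumber R)} (hP : P ∈ 𝒜.Lie) :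
    P ≫ f ∈ 𝒜.Lie := by
  rw [mem_Lie_iff] at hP ⊢
  change 𝒜.pointsMap (TrivSqZeroExt.fstHom R R R) (P ≫ f) = 1
  change 𝒜.pointsMap (TrivSqZeroExt.fstHom R R R) P = 1 at hP
  rw [pointsMap_comp_end, hP]
  exact (IsMonHom.monoidHom f (specOver R R)).map_one

/-- The endomorphism of the group `Lie(A/R)` induced by a group-scheme endomorphism `f`.
[cite: GortzWedhorn2020, Section (6.4) (p. 155)] [cite: Kottwitz1992, §5 (5.2) (p. 390)] -/
def lieEnd (f : 𝒜.X ⟶ 𝒜.X) [IsMonHom f] : 𝒜.Lie →* 𝒜.Lie :=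
  ((𝒜.endPointsHom f (DualNumber R)).restrict 𝒜.Lie).codRestrict 𝒜.Lie fun P => 𝒜.comp_end_mem_Lie f P.2

/-- Unfolding: `(lieEnd f P : A(R[ε])) = P ≫ f`. [cite: GortzWedhorn2020, Section (6.4) (p. 155)] -/
@[simp]
theorem coe_lieEnd_apply (f : 𝒜.X ⟶ 𝒜.X) [IsMonHom f] (P : 𝒜.Lie) :
    ((𝒜.lieEnd f P : 𝒜.Lie) : 𝒜.Points (DualNumber R)) = (P : 𝒜.Points (DualNumber R)) ≫ f := rfl

/-- **The action of `O` on `Lie(A/R)`** through a presented ring action: `a ↦ lieEnd (ιR a)` — the operator whose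
characteristic polynomial [Kottwitz1992, (5.2)] prescribes. [cite: Kottwitz1992, §5 (5.2) (p. 390)] -/
def RingAction.lieEnd {O : Type v} [CommRing O] (act : RingAction O 𝒜) (a : O) : 𝒜.Lie →* 𝒜.Lie :=
  haveI := act.isMonHom a
  𝒜.lieEnd (act.ιR a)

end End

/-! ## The scalar action of `R` on `Lie(A/R)` through `ε ↦ r ε` -/

section Scalar

/-- The `R`-algebra endomorphism `ε ↦ r ε` of the dual numbers `R[ε]` (Mathlib `DualNumber.lift`).
[cite: GortzWedhorn2020, Section (6.4) (p. 155)] -/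
def scaleEps (r : R) : DualNumber R →ₐ[R] DualNumber R :=
  DualNumber.lift ⟨(TrivSqZeroExt.inlAlgHom R R R, r • DualNumber.eps),
    by rw [smul_mul_smul_comm, DualNumber.eps_mul_eps, smul_zero], fun _ => Commute.all _ _⟩

/-- `scaleEps r ε = r ε`. [cite: GortzWedhorn2020, Section (6.4) (p. 155)] -/
@[simp]
theorem scaleEps_eps (r : R) : scaleEps r DualNumber.eps = r • (DualNumber.eps : DualNumber R) :=
  DualNumber.lift_apply_eps _

/-- `ε ↦ 1·ε` is the identity. [cite: GortzWedhorn2020, Section (6.4) (p. 155)] -/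
theorem scaleEps_one : scaleEps (1 : R) = AlgHom.id R (DualNumber R) := by
  apply DualNumber.algHom_ext
  rw [scaleEps_eps, one_smul, AlgHom.id_apply]

/-- `ε ↦ (r s) ε` is `(ε ↦ s ε)` followed by `(ε ↦ r ε)`. [cite: GortzWedhorn2020, Section (6.4) (p. 155)] -/
theorem scaleEps_mul (r s : R) : scaleEps (r * s) = (scaleEps r).comp (scaleEps s) := by
  apply DualNumber.algHom_ext
  rw [scaleEps_eps, AlgHom.comp_apply, scaleEps_eps, map_smul, scaleEps_eps, smul_smul, mul_comm]

/-- Reduction mod `ε` is unchanged by `ε ↦ r ε`. [cite: GortzWedhorn2020, Section (6.4) (p. 155)] -/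
theorem fstHom_comp_scaleEps (r : R) :
    (TrivSqZeroExt.fstHom R R R).comp (scaleEps r) = TrivSqZeroExt.fstHom R R R := by
  apply DualNumber.algHom_ext
  rw [AlgHom.comp_apply, scaleEps_eps, map_smul, TrivSqZeroExt.fstHom_apply, DualNumber.fst_eps, smul_zero]

/-- `ε ↦ 0` factors through `R`: `scaleEps 0 = inl ∘ fst`. [cite: GortzWedhorn2020, Section (6.4) (p. 155)] -/
theorem scaleEps_zero :
    scaleEps (0 : R) = (TrivSqZeroExt.inlAlgHom R R R).comp (TrivSqZeroExt.fstHom R R R) := by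
  apply DualNumber.algHom_ext
  rw [scaleEps_eps, zero_smul, AlgHom.comp_apply, TrivSqZeroExt.fstHom_apply, DualNumber.fst_eps, map_zero]

/-- `ε ↦ r ε` maps `Lie(A/R)` into itself (it does not change the reduction mod `ε`).
[cite: GortzWedhorn2020, Section (6.4) (p. 155)] -/
theorem pointsMap_scaleEps_mem_Lie (r : R) {P : 𝒜.Points (DualNumber R)} (hP : P ∈ 𝒜.Lie) :
    𝒜.pointsMap (scaleEps r) P ∈ 𝒜.Lie := by
  rw [mem_Lie_iff] at hP ⊢
  change 𝒜.pointsMap (TrivSqZeroExt.fstHom R R R) (𝒜.pointsMap (scaleEps r) P) = 1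
  rw [← MonoidHom.comp_apply, ← pointsMap_comp, fstHom_comp_scaleEps]
  exact hP

/-- **The scalar action of `r ∈ R` on `Lie(A/R)`**: `P ↦ A(ε ↦ r ε) P`, an endomorphism of the group `Lie(A/R)`.
[cite: GortzWedhorn2020, Section (6.4) (p. 155)] -/
def lieSMul (r : R) : 𝒜.Lie →* 𝒜.Lie :=
  ((𝒜.pointsMap (scaleEps r)).restrict 𝒜.Lie).codRestrict 𝒜.Lie fun P => 𝒜.pointsMap_scaleEps_mem_Lie r P.2

/-- Unfolding: `(lieSMul r P : A(R[ε])) = A(ε ↦ r ε) P`. [cite: GortzWedhorn2020, Section (6.4) (p. 155)] -/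
@[simp]
theorem coe_lieSMul_apply (r : R) (P : 𝒜.Lie) :
    ((𝒜.lieSMul r P : 𝒜.Lie) : 𝒜.Points (DualNumber R)) = 𝒜.pointsMap (scaleEps r) (P : 𝒜.Points (DualNumber R)) :=
  rfl

/-- `1 · P = P`. [cite: GortzWedhorn2020, Section (6.4) (p. 155)] -/
theorem lieSMul_one (P : 𝒜.Lie) : 𝒜.lieSMul 1 P = P := by
  apply Subtype.ext
  rw [coe_lieSMul_apply, scaleEps_one, pointsMap_id, MonoidHom.id_apply]

/-- `(r s) · P = r · (s · P)`. [cite: GortzWedhorn2020, Section (6.4) (p. 155)] -/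
theorem lieSMul_mul (r s : R) (P : 𝒜.Lie) : 𝒜.lieSMul (r * s) P = 𝒜.lieSMul r (𝒜.lieSMul s P) := by
  apply Subtype.ext
  rw [coe_lieSMul_apply, coe_lieSMul_apply, coe_lieSMul_apply, scaleEps_mul, pointsMap_comp, MonoidHom.comp_apply]

/-- `0 · P = 0` (the identity of the group `Lie`): `ε ↦ 0` factors through `A(R)`, where `P` reduces to the identity.
[cite: GortzWedhorn2020, Section (6.4) (p. 155)] -/
theorem lieSMul_zero (P : 𝒜.Lie) : 𝒜.lieSMul 0 P = 1 := by
  apply Subtype.ext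
  rw [coe_lieSMul_apply, scaleEps_zero, pointsMap_comp, MonoidHom.comp_apply]
  have hP : 𝒜.pointsMap (TrivSqZeroExt.fstHom R R R) (P : 𝒜.Points (DualNumber R)) = 1 := (𝒜.mem_Lie_iff _).1 P.2
  rw [hP, map_one]
  rfl

/-- `r · (P Q) = (r · P)(r · Q)` — `lieSMul r` is a group endomorphism (by construction). [cite: GortzWedhorn2020, Section (6.4) (p. 155)] -/
theorem lieSMul_mul_distrib (r : R) (P Q : 𝒜.Lie) : 𝒜.lieSMul r (P * Q) = 𝒜.lieSMul r P * 𝒜.lieSMul r Q :=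
  map_mul _ P Q

/-- The scalar action commutes with the action of endomorphisms (`A(ε ↦ r ε)` is natural in `A`).
[cite: GortzWedhorn2020, Section (6.4) (p. 155)] -/
theorem lieSMul_lieEnd (r : R) (f : 𝒜.X ⟶ 𝒜.X) [IsMonHom f] (P : 𝒜.Lie) :
    𝒜.lieSMul r (𝒜.lieEnd f P) = 𝒜.lieEnd f (𝒜.lieSMul r P) := by
  apply Subtype.ext
  simp only [coe_lieSMul_apply, coe_lieEnd_apply, pointsMap_comp_end]

end Scalar

end AbelianScheme

end Literature.AlgebraicGeometry.AbelianSchemes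

end
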